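import Summits.MatrixMultiplication.MatrixMultiplication.Theses.DefinableSTPPDichotomy
import Literature.Barriers.MatrixMultiplication.TricoloredSumFreeBarrierEffective

/-!
# `HexagonClearanceR` (crux stmt-MatrixMultiplication-17884): the two repair provisos are jointly
load-bearing

Negative-side lemma from the standing disprover's crux attack (cdisprove cycle 1, 2026-08-17; work
file `Cruxes/HexagonClearanceR/Disproof.lean` §3).  The theorem NEGATES the crux
`Summit.MatrixMultiplication.MatrixMultiplication.Theses.DefinableSTPPDichotomy.HexagonClearanceR`
with BOTH provisos of the 2026-08-17 repair removed — `ε ≤ ε₀` (clearance asked for every `ε > 0`)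
and `q₁ ≤ ringChar F` (replaced by `q₁ ≤ Fintype.card F`) — keeping the pairwise hypothesis, `0 < η`
and the repaired `δ`-free conclusion `|F|^m < mass_J` verbatim (statement INLINED, no new
`def : Prop`), and proves the negation sorry-free:

* `hexagonClearanceR_false_without_eps0_char` — the label-only parasite `A_x = {x} × F, B_x = {0},
  C_x = {(−x,−x)}` over `GF(3ⁿ)` (the witness of `DefinableSTPPDichotomyHexagonClearance_refuted`,
  code adapted from that file) at `ε = 1 + 3c₃/2`, `η = c₃/2` satisfies every `≥ 2`-equal-label
  pattern and has mass `q^{2+η}` exactly, while its fully-STPP sub-families are cap sets, of mass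
  `≤ 3 q^{2 − c₃/2} < q²` by the tree's `card_le_rpow_of_elementary` (`c₃ = foxLovaszExponent 3 > 0`,
  Ellenberg–Gijswijt / BCCGNSU Thm 4.14).

So even the repaired conclusion fails at a FIXED `ε > 1` in bounded characteristic; the crux survives
this witness through EITHER proviso (`ε ≤ ε₀ < 1` starves the parasite's mass — the route's
`TranslateFamiliesFail`; `char F → ∞` sends the cap-set saving `c_p → 0` — Behrend).  Taken one at a
time: `q₁ ≤ ringChar F` alone is NOT load-bearing modulo the recurrence principle of
`Cruxes/PairwiseCurvedTilingsLC/LonelyTranslates.lean` (its `¬LC` proof is characteristic-free and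
`¬LC → R`); `ε ≤ ε₀` alone is open (needs a power-saving nonlinear Roth bound over prime fields;
Disproof.lean §4).  This does not refute the crux.

References: J. Blasiak, T. Church, H. Cohn, J. A. Grochow, E. Naslund, W. F. Sawin, C. Umans,
Discrete Analysis 2017:3 (arXiv:1605.06702) Thm 4.14; J. S. Ellenberg, D. Gijswijt, Ann. of Math.
185 (2017); H. Cohn, R. Kleinberg, B. Szegedy, C. Umans, FOCS 2005 (arXiv:math/0511460) Def. 5.1.
-/

set_option linter.dupNamespace false  -- `Summit.<S>.<S>.…` is the mandated namespace

namespace Summit.MatrixMultiplication.MatrixMultiplication.Theorems.HexagonClearanceR.Negative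

open Finset FirstOrder FirstOrder.Language
open Summit.MatrixMultiplication.MatrixMultiplication.Theses.DefinableSTPPDichotomy

/-- **The pair of provisos {`ε ≤ ε₀`, `q₁ ≤ ringChar F`} is jointly load-bearing, even for the
repaired `δ`-free conclusion.**  Drop both and the label-only parasite of the old seam returns:
`F = GF(3ⁿ)`, `m = 2`, `x ∈ I = F`, `A_x = {x} × F`, `B_x = {0}`, `C_x = {(−x,−x)}` meets every
`≥ 2`-equal-label pattern; at `ε = 1 + 3c₃/2`, `η = c₃/2` (`c₃ = foxLovaszExponent 3 > 0`) its mass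
is `q · q^{1 + c₃/2} = q^{2+η}` exactly; a fully-STPP `J` is a cap set (`i + j = 2k ⇒ i = j = k`),
so `|J| ≤ 3 q^{1−c₃}` (tree `card_le_rpow_of_elementary`) and `mass_J ≤ 3 q^{2−c₃/2} < q² = |F|^m`
once `q^{c₃/2} > 3`.  So in bounded characteristic the conclusion fails at a FIXED `ε > 1`; the
repaired item survives this witness through EITHER proviso (`ε ≤ ε₀ < 1` starves the parasite's mass,
TranslateFamiliesFail; `char F → ∞` sends the cap-set saving `c_p → 0`, Behrend). [folklore] -/
theorem hexagonClearanceR_false_without_eps0_char :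
    ¬ (∀ (e m k : ℕ) (φI : Language.ring.Formula (Fin e ⊕ Fin k))
        (φA φB φC : Language.ring.Formula ((Fin e ⊕ Fin m) ⊕ Fin k)),
        ∀ ε η : ℝ, 0 < ε → 0 < η → ∃ q₁ : ℕ,
          ∀ (F : Type) [Field F] [Fintype F] [FirstOrder.Ring.CompatibleRing F], q₁ ≤ Fintype.card F →
            ∀ (y : Fin k → F) (I : Finset (Fin e → F)) (A B C : (Fin e → F) → Finset (Fin m → F)),
              (∀ x, x ∈ I ↔ φI.Realize (Sum.elim x y)) →
              (∀ x v, v ∈ A x ↔ φA.Realize (Sum.elim (Sum.elim x v) y)) →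
              (∀ x v, v ∈ B x ↔ φB.Realize (Sum.elim (Sum.elim x v) y)) →
              (∀ x v, v ∈ C x ↔ φC.Realize (Sum.elim (Sum.elim x v) y)) →
              (∀ i ∈ I, ∀ j ∈ I, ∀ k ∈ I, (i = j ∨ j = k ∨ k = i) →
                ∀ s ∈ A k, ∀ s' ∈ A i, ∀ t ∈ B i, ∀ t' ∈ B j, ∀ u ∈ C j, ∀ u' ∈ C k,
                  (s' - s) + (t' - t) + (u' - u) = 0 → i = j ∧ j = k ∧ s = s' ∧ t = t' ∧ u = u') →
              (Fintype.card F : ℝ) ^ ((m : ℝ) + η) ≤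
                ∑ x ∈ I, (((A x).card * (B x).card * (C x).card : ℕ) : ℝ) ^ ((2 + ε) / 3) →
              ∃ J : Finset (Fin e → F), J ⊆ I ∧
                (∀ i ∈ J, ∀ j ∈ J, ∀ k ∈ J, ∀ s ∈ A k, ∀ s' ∈ A i, ∀ t ∈ B i, ∀ t' ∈ B j,
                  ∀ u ∈ C j, ∀ u' ∈ C k, (s' - s) + (t' - t) + (u' - u) = 0 →
                    i = j ∧ j = k ∧ s = s' ∧ t = t' ∧ u = u') ∧
                (Fintype.card F : ℝ) ^ (m : ℝ) <
                  ∑ x ∈ J, (((A x).card * (B x).card * (C x).card : ℕ) : ℝ) ^ ((2 + ε) / 3)) := by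
  intro H
  classical
  -- ring formulas (label `x : Fin 1`, vector `v : Fin 2`, no parameters):
  -- `φA : v₀ = x₀`, `φB : v₀ = 0 ∧ v₁ = 0`, `φC : v₀ + x₀ = 0 ∧ v₁ + x₀ = 0`
  let V0 : Language.ring.Term ((Fin 1 ⊕ Fin 2) ⊕ Fin 0) := Term.var (Sum.inl (Sum.inr 0))
  let V1 : Language.ring.Term ((Fin 1 ⊕ Fin 2) ⊕ Fin 0) := Term.var (Sum.inl (Sum.inr 1))
  let X0 : Language.ring.Term ((Fin 1 ⊕ Fin 2) ⊕ Fin 0) := Term.var (Sum.inl (Sum.inl 0))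
  let φA : Language.ring.Formula ((Fin 1 ⊕ Fin 2) ⊕ Fin 0) := Term.equal V0 X0
  let φB : Language.ring.Formula ((Fin 1 ⊕ Fin 2) ⊕ Fin 0) := Term.equal V0 0 ⊓ Term.equal V1 0
  let φC : Language.ring.Formula ((Fin 1 ⊕ Fin 2) ⊕ Fin 0) :=
    Term.equal (V0 + X0) 0 ⊓ Term.equal (V1 + X0) 0
  have hc : 0 < Literature.Combinatorics.Additive.foxLovaszExponent 3 :=
    Literature.Combinatorics.Additive.foxLovaszExponent_pos (by norm_num)
  generalize hcdef : Literature.Combinatorics.Additive.foxLovaszExponent 3 = c at hc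
  obtain ⟨q₁, hq₁⟩ := H 1 2 0 ⊤ φA φB φC (1 + 3 * (c / 2)) (c / 2) (by positivity) (half_pos hc)
  -- the field `GF(3ⁿ)`, `n = q₁ + ⌈2/c⌉ + 1`
  obtain ⟨n, hn0, hq₁n, hn2⟩ : ∃ n : ℕ, n ≠ 0 ∧ q₁ ≤ n ∧ (2 / c : ℝ) < n :=
    ⟨q₁ + ⌈2 / c⌉₊ + 1, by omega, by omega, Nat.lt_of_ceil_lt (by omega)⟩
  let F := GaloisField 3 n
  letI : Fintype F := Fintype.ofFinite F
  letI : FirstOrder.Ring.CompatibleRing F := FirstOrder.Ring.compatibleRingOfRing F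
  have hcardF : Fintype.card F = 3 ^ n := by
    rw [← Nat.card_eq_fintype_card]
    exact GaloisField.card 3 n hn0
  have hF : q₁ ≤ Fintype.card F := by
    rw [hcardF]
    exact hq₁n.trans (Nat.lt_pow_self (by norm_num)).le
  have hQpos : (0 : ℝ) < Fintype.card F := by exact_mod_cast Fintype.card_pos
  have h3 : (3 : F) = 0 := by
    have h := CharP.cast_eq_zero F 3
    simpa using h
  have hG : ∀ x : F, 3 • x = 0 := fun x => by
    rw [nsmul_eq_mul, Nat.cast_ofNat, h3, zero_mul]
  -- the parasite family: `A_x = {v : v₀ = x₀}` (a line), `B_x = {0}`, `C_x = {(−x₀,−x₀)}`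
  let A : (Fin 1 → F) → Finset (Fin 2 → F) := fun x => univ.filter fun v => v 0 = x 0
  let B : (Fin 1 → F) → Finset (Fin 2 → F) := fun _ => {0}
  let C : (Fin 1 → F) → Finset (Fin 2 → F) := fun x => {fun _ => -(x 0)}
  have memA : ∀ {x : Fin 1 → F} {v : Fin 2 → F}, v ∈ A x ↔ v 0 = x 0 := by
    intro x v; simp [A]
  have memB : ∀ {x : Fin 1 → F} {v : Fin 2 → F}, v ∈ B x ↔ v = 0 := by
    intro x v; exact Finset.mem_singleton
  have memC : ∀ {x : Fin 1 → F} {v : Fin 2 → F}, v ∈ C x ↔ v = fun _ => -(x 0) := by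
    intro x v; exact Finset.mem_singleton
  have cardA : ∀ x : Fin 1 → F, (A x).card = Fintype.card F := by
    intro x
    rw [← Finset.card_univ (α := F)]
    refine Finset.card_nbij' (fun v => v 1) (fun z l => if l = 0 then x 0 else z) ?_ ?_ ?_ ?_
    · intro v _
      simp
    · intro z _
      simp [memA]
    · intro v hv
      have hv0 : v 0 = x 0 := memA.1 (Finset.mem_coe.1 hv)
      funext l
      fin_cases l <;> simp [hv0]
    · intro z _
      simp
  have cardB : ∀ x : Fin 1 → F, (B x).card = 1 := fun x => Finset.card_singleton _
  have cardC : ∀ x : Fin 1 → F, (C x).card = 1 := fun x => Finset.card_singleton _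
  have realA : ∀ (x : Fin 1 → F) (v : Fin 2 → F),
      v ∈ A x ↔ φA.Realize (Sum.elim (Sum.elim x v) ![]) := by
    intro x v
    simp [A, φA, V0, X0, Formula.realize_equal]
  have realB : ∀ (x : Fin 1 → F) (v : Fin 2 → F),
      v ∈ B x ↔ φB.Realize (Sum.elim (Sum.elim x v) ![]) := by
    intro x v
    simp [B, φB, V0, V1, Formula.realize_equal, Formula.realize_inf, funext_iff, Fin.forall_fin_two]
  have realC : ∀ (x : Fin 1 → F) (v : Fin 2 → F),
      v ∈ C x ↔ φC.Realize (Sum.elim (Sum.elim x v) ![]) := by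
    intro x v
    simp [C, φC, V0, V1, X0, Formula.realize_equal, Formula.realize_inf, funext_iff,
      Fin.forall_fin_two, eq_neg_iff_add_eq_zero]
  -- instantiate the variant at the parasite family
  have key := hq₁ F hF ![] univ A B C (fun x => by simp) realA realB realC
  obtain ⟨J, -, hJstpp, hJmass⟩ := key
    (by
      intro i _ j _ k _ hcase s hs s' hs' t ht t' ht' u hu u' hu' hsum
      simp only [A, B, C, Finset.mem_filter, Finset.mem_univ, true_and,
        Finset.mem_singleton] at hs hs' ht ht' hu hu'
      subst ht ht' hu hu'
      have e0 := congrFun hsum 0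
      have e1 := congrFun hsum 1
      simp only [Pi.add_apply, Pi.sub_apply, Pi.zero_apply] at e0 e1
      have hijk : i 0 = j 0 ∧ j 0 = k 0 := by
        rcases hcase with h | h | h
        · have h0 := congrFun h 0
          exact ⟨h0, by linear_combination (j 0 - k 0) * h3 - e0 + hs' - hs + h0⟩
        · have h0 := congrFun h 0
          exact ⟨by linear_combination e0 - hs' + hs - 2 * h0, h0⟩
        · have h0 := congrFun h 0
          exact ⟨by linear_combination hs' - e0 - hs - 2 * h0,
            by linear_combination e0 - hs' + hs + h0⟩
      have hij : i = j := funext fun l => by rw [Fin.fin_one_eq_zero l]; exact hijk.1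
      have hjk : j = k := funext fun l => by rw [Fin.fin_one_eq_zero l]; exact hijk.2
      refine ⟨hij, hjk, funext (Fin.forall_fin_two.2 ⟨?_, ?_⟩), rfl, by rw [hjk]⟩
      · linear_combination hs - hs' - hijk.1 - hijk.2
      · linear_combination hijk.2 - e1)
    (by
      simp only [cardA, cardB, cardC, mul_one, sum_const, card_univ, Fintype.card_fun,
        Fintype.card_fin, pow_one, nsmul_eq_mul, Nat.cast_ofNat]
      rw [show ((2 : ℝ) + (1 + 3 * (c / 2))) / 3 = 1 + c / 2 by ring,
        show (2 : ℝ) + c / 2 = 1 + (1 + c / 2) by ring, Real.rpow_add hQpos, Real.rpow_one])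
  -- a fully-STPP sub-family is a tricolored sum-free set `(x, x, x)_{x ∈ J}` in `(F,+)`, `3·F = 0`
  have hTSF : Literature.Combinatorics.Additive.IsTricoloredSumFree
      (fun a : ↥J => (a.1 0 : F)) (fun a : ↥J => a.1 0) (fun a : ↥J => a.1 0) := by
    intro a b d
    constructor
    · intro hsum
      have h := hJstpp a.1 a.2 b.1 b.2 d.1 d.2 (fun _ => d.1 0) (by simp [memA])
        (fun _ => a.1 0) (by simp [memA]) 0 (by simp [memB]) 0 (by simp [memB])
        (fun _ => -(b.1 0)) (by simp [memC]) (fun _ => -(d.1 0)) (by simp [memC])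
        (by
          funext l
          simp only [Pi.add_apply, Pi.sub_apply, Pi.zero_apply]
          linear_combination hsum - (d.1 0) * h3)
      exact ⟨Subtype.ext h.1, Subtype.ext h.2.1⟩
    · rintro ⟨rfl, rfl⟩
      linear_combination (a.1 0) * h3
  have hJle := Literature.Barriers.MatrixMultiplication.card_le_rpow_of_elementary
    Nat.prime_three F hG ↥J _ _ _ hTSF
  rw [Fintype.card_coe, hcdef] at hJle
  -- the mass of `J`
  simp only [cardA, cardB, cardC, mul_one, sum_const, nsmul_eq_mul, Nat.cast_ofNat] at hJmass
  -- `3 < q^{c/2}` since `q = 3ⁿ`, `n c / 2 > 1`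
  have h3lt : (3 : ℝ) < (Fintype.card F : ℝ) ^ (c / 2) := by
    have hQ3 : (Fintype.card F : ℝ) = (3 : ℝ) ^ (n : ℝ) := by
      rw [hcardF]
      push_cast
      exact (Real.rpow_natCast 3 n).symm
    have h1lt : (1 : ℝ) < n * (c / 2) := by
      have h1 : (2 / c) * (c / 2) = (1 : ℝ) := by field_simp
      calc (1 : ℝ) = (2 / c) * (c / 2) := h1.symm
        _ < n * (c / 2) := by gcongr
    rw [hQ3, ← Real.rpow_mul (by norm_num : (0 : ℝ) ≤ 3)]
    calc (3 : ℝ) = 3 ^ (1 : ℝ) := (Real.rpow_one 3).symm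
      _ < 3 ^ ((n : ℝ) * (c / 2)) := Real.rpow_lt_rpow_of_exponent_lt (by norm_num) h1lt
  -- contradiction: q² < |J| q^{1+c/2} ≤ 3 q^{1-c} q^{1+c/2} < q^{c/2} q^{1-c} q^{1+c/2} = q²
  have key2 : (Fintype.card F : ℝ) ^ (2 : ℝ) < (Fintype.card F : ℝ) ^ (2 : ℝ) :=
    calc (Fintype.card F : ℝ) ^ (2 : ℝ)
        < (J.card : ℝ) * (Fintype.card F : ℝ) ^ (((2 : ℝ) + (1 + 3 * (c / 2))) / 3) := hJmass
      _ ≤ 3 * (Fintype.card F : ℝ) ^ (1 - c) *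
            (Fintype.card F : ℝ) ^ (((2 : ℝ) + (1 + 3 * (c / 2))) / 3) :=
          mul_le_mul_of_nonneg_right hJle (Real.rpow_nonneg hQpos.le _)
      _ < (Fintype.card F : ℝ) ^ (c / 2) * (Fintype.card F : ℝ) ^ (1 - c) *
            (Fintype.card F : ℝ) ^ (((2 : ℝ) + (1 + 3 * (c / 2))) / 3) :=
          mul_lt_mul_of_pos_right (mul_lt_mul_of_pos_right h3lt (Real.rpow_pos_of_pos hQpos _))
            (Real.rpow_pos_of_pos hQpos _)
      _ = (Fintype.card F : ℝ) ^ (c / 2 + (1 - c) + ((2 : ℝ) + (1 + 3 * (c / 2))) / 3) := by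
          rw [Real.rpow_add hQpos, Real.rpow_add hQpos]
      _ = (Fintype.card F : ℝ) ^ (2 : ℝ) := by
          congr 1
          ring
  exact lt_irrefl _ key2

end Summit.MatrixMultiplication.MatrixMultiplication.Theorems.HexagonClearanceR.Negative
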